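import Summits.AtomisticToContinuum.Crystallization.Theorems.AperiodicFrustratedLawGap.Negative.OffAtlasCapCeilingTransport
import Summits.AtomisticToContinuum.Crystallization.Theorems.AperiodicFrustratedLawGap.Negative.OffAtlasCapCeilingTransportShell
import Summits.AtomisticToContinuum.Crystallization.Theorems.FrustratedLawDichotomyCoordPull

/-!
# Crux `AperiodicFrustratedLawGap` (stmt-AtomisticToContinuum-27623) · NEGATIVE lane — BOTH CAP-FLOOR WITNESSES OF RECORD ARE EARNERS UNDER THE
# COORDINATION PULL: neither (410)'s `0.613` nor (434)'s `0.24888` transfers to `coordPull (7/10) 16 (11/10) (11/10) a`, `a ≥ 1/30`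
# (decomp-a2c, (404′) transported line, hand-1 g58 (H5); companion of `…FrustratedLawDichotomyCoordPull`, pattern of (421) `…Negative.OffAtlasCapCeilingTransport`)

The K2 price sheet of record (critic r1926/r1930): every SITEWISE cap has `D ≥ 0.613` ((410)/(411): the 177-point witness `clusterMeasure`, root
over-bound by 24 COMPRESSED first-shell atoms), every transported cap of the COMPRESSION pull `compPull r₁ R a`, `r₁ ≤ 4/5`, has `D_T ≥ 0.24888`
((434): the 247-point contact-free witness `shellMeasure`, root over-bound by 20 first-shell atoms, `net = 0`).  Both roots are OVER-COORDINATED.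
This file reads the two witnesses under the coordination pull of `…CoordPull` with `k = 16` other atoms within `ρ = 11/10`, pull radius `R = 11/10`:
* §1 kernel-decided coordination profiles (one `decide +kernel` each, integer arithmetic on the tree's witness lists `W` (410) and `WS` (434)):
  among the 24 first-shell vectors of `W` exactly 21 have fewer than 16 cluster points within `11/10` (`payW`, coordination 13–15 counting the root);
  all 20 first-shell vectors of `WS` (`WS20`, `|v|² ≤ 121`) have at most 13; `Σ_{v∈WS} g(|v|²) ≥ −2071/1000`.
* §2 metric readings (`√`-arithmetic: `dist ≤ 11/10 ⟺ |s − t|² ≤ 121` on the integer grid).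
* §3 (410) under the coordination pull: the root is over-coordinated (`T24` of (421): 24 ≥ 16 atoms within `11/10`), the 21 atoms of `TW` are
  under-coordinated atoms within `11/10` (`not_overCoord_of_subset_finset` with the explicit neighbour lists), so (B) `card_mul_le_net_coordPull` books
  `≥ 21·a` at the root: ★ `transportedDeficit_cluster_le : e⋆ − rootEnergy − net ≤ E + 7/5 − 21a` for every ceiling `e⋆ ≤ E`.
* §4 (434) likewise: root over-coordinated (20 ≥ 16), all 20 first-shell atoms under-coordinated, income `≥ 20·a`,
  ★ `transportedDeficit_shell_le : e⋆ − rootEnergy − net ≤ E + 2071/2000 − 20a`.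
* §5 ★★ with the tree ceiling `e⋆ ≤ −0.7175` (`…PeriodicEnergyCeilingKernel.eStar_le`): for every `a ≥ 1/30` BOTH transported deficits are `≤ 0`
  (`transportedDeficit_cluster_nonpos`, `transportedDeficit_shell_nonpos`), so both witnesses satisfy EVERY cap `D ≥ 0` (`witnesses_capT`) and the two
  floor implications of record are FALSE for this kernel (`not_capFloor_transfer_coordPull`, `not_shellCapFloor_transfer_coordPull`, take `D = 0`).
HONEST LABELS.  A statement about TWO configurations and ONE kernel instance; it certifies NO transported cap `D_T` for `coordPull` (K2, kit-sized, not
licensed here) and says nothing about A(η).  What it does NOT book away, stated so that nobody reads a reach figure into it: (i) an UNDER-coordinated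
over-bound root — desk reading (not certified): an icosahedral centre (12 atoms at `1.0`, mutual `1.05`) inside a contact-free `0.93`-separated far field
has coordination 12 < 16, books no income, and has sitewise deficit `≈ 0.08–0.1`; a contact-free Tammes-14 first shell at radius `1.0` (chord `0.93`)
likewise (`≈ 0.14`) — these are the cheapest falsifiers of any «`D_T(coordPull 16) < 0.1`» claim; (ii) what under-coordinated roots PAY next to
over-coordinated atoms ((B) `neg_card_mul_le_net_coordPull`: `≤ a` per such atom within `R`) — lowering `k` turns the roots of (i) into earners and every
`< k`-coordinated root into a payer; the trade-off is the K2 certificate's business.  Imports: TREE (421) `…Negative.OffAtlasCapCeilingTransport`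
(hence (410)), (434) `…Negative.OffAtlasCapCeilingTransportShell`, and (B) `…FrustratedLawDichotomyCoordPull`.  4 plain `def`s (`near`, `payW`, `WS20`
lists; `coordOK : Bool`) + 2 `Finset`s (`TW`, `TS`); no instance / notation / option; `decide +kernel` only (no `native_decide`); 0 sorry.
-/

noncomputable section

namespace Summit.AtomisticToContinuum.Crystallization.Theorems.AperiodicFrustratedLawGap.Negative.OffAtlasCapCeilingCoordPull

open MeasureTheory Metric Set
open scoped ENNReal BigOperators
open Literature.MathematicalPhysics.StatisticalMechanics Literature.Probability.Process
open Summit.AtomisticToContinuum.Crystallization.Theorems.ChargedEnergyGapNegative (E3 eStar)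
open Summit.AtomisticToContinuum.Crystallization.Theorems.FrustratedLawDichotomySignedLedger (net)
open Summit.AtomisticToContinuum.Crystallization.Theorems.FrustratedLawDichotomyPeriodicEnergyCeilingKernel (eStar_le)
open Summit.AtomisticToContinuum.Crystallization.Theorems.AperiodicFrustratedLawGap.Negative.OffAtlasCapCeiling
  (W W_spec sq3 sub3 pt norm_pt dist_pt pt_injOn pt_ne_zero cluster clusterMeasure isRootedHardCore_cluster gQ rootEnergy_cluster_le)
open Summit.AtomisticToContinuum.Crystallization.Theorems.AperiodicFrustratedLawGap.Negative.OffAtlasCapCeilingTwoCone (capFloor capFloor_eq)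
open Summit.AtomisticToContinuum.Crystallization.Theorems.AperiodicFrustratedLawGap.Negative.OffAtlasCapCeilingTransport
  (W24 shell_spec W24_subset nodup_W24 norm_pt_le clusterMeasure_singleton_ne_zero T24 card_T24 T24_spec rootEnergy_cluster_ge)
open Summit.AtomisticToContinuum.Crystallization.Theorems.AperiodicFrustratedLawGap.Negative.OffAtlasCapCeilingTransportShell
  (WS WS_spec ptS_injOn ptS_ne_zero shell shellMeasure isRootedHardCore_shell rootEnergy_shell shellCapFloor shellCapFloor_eq)
open Summit.AtomisticToContinuum.Crystallization.Theorems.FrustratedLawDichotomyCoordPull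
  (OverCoord coordPull overCoord_of_finset not_overCoord_of_subset_finset card_mul_le_net_coordPull)

/-! ## §1. Integer neighbour lists and the kernel-decided coordination profiles -/

/-- The vectors of `L` OTHER than `t` within `|s − t|² ≤ 121` (distance `≤ 11/10` on the `1/10` grid). [new: bookkeeping] -/
def near (L : List (ℤ × ℤ × ℤ)) (t : ℤ × ℤ × ℤ) : List (ℤ × ℤ × ℤ) := L.filter fun s => decide (s ≠ t ∧ sq3 (sub3 s t) ≤ 121)

/-- (410): the first-shell vectors with FEWER THAN 16 cluster points (root included) within `11/10` — the payers. [new: witness data] -/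
def payW : List (ℤ × ℤ × ℤ) := W24.filter fun t => decide ((near W t).length + 1 < 16)

/-- (434): the first shell of the contact-free witness, its 20 innermost vectors (`99 ≤ |v|² ≤ 115`; `WS` is sorted by `|v|²`). [new: witness data] -/
def WS20 : List (ℤ × ℤ × ℤ) := WS.take 20

/-- Boolean checker: `payW` has 21 members; every `WS20` vector has `|v|² ≤ 121` and fewer than 16 cluster points within `11/10`. [new: bookkeeping] -/
def coordOK : Bool := (payW.length == 21) && WS20.all fun t => decide (sq3 t ≤ 121) && decide ((near WS t).length + 1 < 16)

/-- The kernel decides the coordination profiles (`24 × 176` and `20 × 246` integer distance tests). [new: certificate] -/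
theorem coordOK_true : coordOK = true := by decide +kernel

/-- `payW` has 21 members. [new: certificate] -/
theorem length_payW : payW.length = 21 := by
  have h := coordOK_true
  simp only [coordOK, Bool.and_eq_true, beq_iff_eq] at h
  exact h.1

/-- The (434) first-shell facts, unpacked. [new: certificate] -/
theorem WS20_spec : ∀ t ∈ WS20, sq3 t ≤ 121 ∧ (near WS t).length + 1 < 16 := by
  have h := coordOK_true
  simp only [coordOK, Bool.and_eq_true, List.all_eq_true, decide_eq_true_eq] at h
  exact fun t ht => ⟨(h.2 t ht).1, (h.2 t ht).2.trans_le (by norm_num)⟩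

/-- `WS20` has 20 members. [new: certificate] -/
theorem length_WS20 : WS20.length = 20 := by decide +kernel

/-- `WS20` has no repeated vector ((434) `WS_spec`). [folklore] -/
theorem nodup_WS20 : WS20.Nodup := (List.take_sublist 20 WS).nodup WS_spec.2.2

/-- First-shell vectors of (434) are witness vectors. [folklore] -/
theorem WS20_subset : ∀ t ∈ WS20, t ∈ WS := fun _ ht => List.mem_of_mem_take ht

/-- `payW` members are first-shell vectors with the booked neighbour count; no repetition. [new: certificate] -/
theorem payW_spec : ∀ t ∈ payW, t ∈ W24 ∧ (near W t).length + 1 < 16 := fun t ht => by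
  have h := List.mem_filter.1 ht
  exact ⟨h.1, of_decide_eq_true h.2⟩

/-- `payW` has no repeated vector ((421) `nodup_W24`). [folklore] -/
theorem nodup_payW : payW.Nodup := nodup_W24.filter _

/-- Membership in a neighbour list, unpacked. [new: bookkeeping] -/
theorem mem_near {L : List (ℤ × ℤ × ℤ)} {s t : ℤ × ℤ × ℤ} (hs : s ∈ L) (hst : s ≠ t) (hd : sq3 (sub3 s t) ≤ 121) : s ∈ near L t :=
  List.mem_filter.2 ⟨hs, decide_eq_true ⟨hst, hd⟩⟩

/-- The kernel sums the 246 rational pair energies of (434) FROM BELOW: `Σ g ≥ −2071/1000` (value `−2.07073…`). [new: certificate] -/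
theorem sum_gQ_WS_ge : -(2071 / 1000 : ℚ) ≤ (WS.map fun t => gQ (sq3 t)).sum := by decide +kernel

/-! ## §2. Metric readings on the `1/10` grid -/

/-- `dist (s/10) (t/10) ≤ 11/10 ⟹ |s − t|² ≤ 121`. [folklore] -/
theorem sq3_le_of_dist_le {s t : ℤ × ℤ × ℤ} (h : dist (pt s) (pt t) ≤ 11 / 10) : sq3 (sub3 s t) ≤ 121 := by
  by_contra hlt
  have h122 : (121 : ℝ) < (sq3 (sub3 s t) : ℝ) := by exact_mod_cast (not_le.1 hlt)
  have h11 : (11 : ℝ) < Real.sqrt (sq3 (sub3 s t) : ℝ) := (Real.lt_sqrt (by norm_num)).2 (by nlinarith)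
  rw [dist_pt] at h
  linarith

/-! ## §3. The (410) witness under the coordination pull: 24 ≥ 16 at the root, 21 under-coordinated payers -/

/-- Atoms of the (410) witness are the root or scaled witness vectors. [folklore] -/
theorem eq_of_cluster_atom {z : E3} (hz : clusterMeasure {z} ≠ 0) : z = 0 ∨ ∃ s ∈ W, pt s = z := by
  have h := (count_restrict_singleton_ne_zero_iff _ z).1 hz
  simpa only [cluster, Finset.coe_insert, Finset.mem_coe, Set.mem_insert_iff, List.mem_toFinset, List.mem_map] using h

/-- The root of the (410) witness is an atom. [folklore] -/
theorem cluster_root_atom : clusterMeasure {0} ≠ 0 := by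
  rw [isRootedHardCore_cluster.measure_zero_singleton]; exact one_ne_zero

/-- ★ THE (410) ROOT IS OVER-COORDINATED: its 24 first-shell atoms lie within `11/10` ((421) `T24_spec`, `card_T24`). [new: certificate] -/
theorem overCoord_cluster_root : OverCoord (7 / 10) 16 (11 / 10) clusterMeasure 0 := by
  refine overCoord_of_finset isRootedHardCore_cluster cluster_root_atom T24 (fun z hz => ?_) (by rw [card_T24]; norm_num)
  obtain ⟨hat, hn, -⟩ := T24_spec z hz
  have hz' : z ∈ (W24.map pt).toFinset := hz
  rw [List.mem_toFinset, List.mem_map] at hz'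
  obtain ⟨t, ht, rfl⟩ := hz'
  exact ⟨hat, pt_ne_zero t (W24_subset t ht), by rwa [dist_zero_right]⟩

/-- ★ A SHORT NEIGHBOUR LIST MEANS UNDER-COORDINATED: the cluster atoms `≠ t/10` within `11/10` of it are the root or `s/10`, `s ∈ near W t`. [new: certificate] -/
theorem not_overCoord_cluster {t : ℤ × ℤ × ℤ} (ht : t ∈ W) (hlen : (near W t).length + 1 < 16) :
    ¬ OverCoord (7 / 10) 16 (11 / 10) clusterMeasure (pt t) := by
  classical
  refine not_overCoord_of_subset_finset isRootedHardCore_cluster (clusterMeasure_singleton_ne_zero ht) (insert 0 ((near W t).map pt).toFinset)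
    (fun z hz hne hd => ?_) ?_
  · rcases eq_of_cluster_atom hz with rfl | ⟨s, hs, rfl⟩
    · exact Finset.mem_insert_self _ _
    · exact Finset.mem_insert_of_mem (List.mem_toFinset.2 (List.mem_map.2 ⟨s, mem_near hs (fun h => hne (by rw [h])) (sq3_le_of_dist_le hd), rfl⟩))
  · calc (insert 0 ((near W t).map pt).toFinset).card ≤ ((near W t).map pt).toFinset.card + 1 := Finset.card_insert_le _ _
      _ ≤ (near W t).length + 1 := by
          have h := List.toFinset_card_le ((near W t).map pt)
          rw [List.length_map] at h
          omega
      _ < 16 := hlen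

/-- ★ The 21 under-coordinated first-shell atoms of (410), as a finite set of points of `ℝ³`. [new: witness] -/
def TW : Finset E3 := (payW.map pt).toFinset

/-- It has exactly 21 points. [new: certificate] -/
theorem card_TW : TW.card = 21 := by
  have hnd : (payW.map pt).Nodup := nodup_payW.map_on fun s hs t ht h =>
    pt_injOn s (W24_subset s (payW_spec s hs).1) t (W24_subset t (payW_spec t ht).1) h
  rw [TW, List.toFinset_card_of_nodup hnd, List.length_map, length_payW]

/-- ★ Every point of `TW` is an atom within `11/10` of the root and is UNDER-COORDINATED: the `hT` binder of (B) `card_mul_le_net_coordPull`. [new: certificate] -/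
theorem TW_spec : ∀ y ∈ TW, clusterMeasure {y} ≠ 0 ∧ ‖y‖ ≤ 11 / 10 ∧ ¬ OverCoord (7 / 10) 16 (11 / 10) clusterMeasure y := by
  intro y hy
  simp only [TW, List.mem_toFinset, List.mem_map] at hy
  obtain ⟨t, ht, rfl⟩ := hy
  obtain ⟨ht24, hlen⟩ := payW_spec t ht
  exact ⟨clusterMeasure_singleton_ne_zero (W24_subset t ht24), norm_pt_le (shell_spec.1 t ht24).1, not_overCoord_cluster (W24_subset t ht24) hlen⟩

/-- ★ The coordination pull books `≥ 21·a` of income at the (410) root. [new: negative] -/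
theorem net_cluster_ge {a : ℝ} (ha : 0 ≤ a) : 21 * a ≤ net 0 (coordPull (7 / 10) 16 (11 / 10) (11 / 10) a) clusterMeasure := by
  have h := card_mul_le_net_coordPull (by norm_num) ha isRootedHardCore_cluster overCoord_cluster_root TW TW_spec
  rw [card_TW, show ((21 : ℕ) : ℝ) = 21 by norm_num] at h
  exact h

/-- ★ THE TRANSPORTED DEFICIT OF THE (410) WITNESS under the coordination pull, against any ceiling `e⋆ ≤ E`: `≤ E + 7/5 − 21·a`. [new: negative] -/
theorem transportedDeficit_cluster_le {a : ℝ} (ha : 0 ≤ a) {E : ℝ} (hE : eStar ≤ E) :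
    eStar - rootEnergy lennardJones clusterMeasure - net 0 (coordPull (7 / 10) 16 (11 / 10) (11 / 10) a) clusterMeasure ≤ E + 7 / 5 - 21 * a := by
  linarith [net_cluster_ge ha, rootEnergy_cluster_ge]

/-! ## §4. The (434) witness under the coordination pull: 20 ≥ 16 at the root, all 20 first-shell atoms pay -/

/-- Atoms of the (434) witness are the root or scaled witness vectors. [folklore] -/
theorem eq_of_shell_atom {z : E3} (hz : shellMeasure {z} ≠ 0) : z = 0 ∨ ∃ s ∈ WS, pt s = z := by
  have h := (count_restrict_singleton_ne_zero_iff _ z).1 hz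
  simpa only [shell, Finset.coe_insert, Finset.mem_coe, Set.mem_insert_iff, List.mem_toFinset, List.mem_map] using h

/-- Witness vectors of (434) are atoms. [folklore] -/
theorem shellMeasure_singleton_ne_zero {t : ℤ × ℤ × ℤ} (ht : t ∈ WS) : shellMeasure {pt t} ≠ 0 := by
  refine (count_restrict_singleton_ne_zero_iff _ _).2 (Finset.mem_coe.2 ?_)
  simp only [shell, Finset.mem_insert, List.mem_toFinset, List.mem_map]
  exact Or.inr ⟨t, ht, rfl⟩

/-- The root of the (434) witness is an atom. [folklore] -/
theorem shell_root_atom : shellMeasure {0} ≠ 0 := by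
  rw [isRootedHardCore_shell.measure_zero_singleton]; exact one_ne_zero

/-- ★ A (434) ATOM WITH A SHORT NEIGHBOUR LIST IS UNDER-COORDINATED. [new: certificate] -/
theorem not_overCoord_shell {t : ℤ × ℤ × ℤ} (ht : t ∈ WS) (hlen : (near WS t).length + 1 < 16) :
    ¬ OverCoord (7 / 10) 16 (11 / 10) shellMeasure (pt t) := by
  classical
  refine not_overCoord_of_subset_finset isRootedHardCore_shell (shellMeasure_singleton_ne_zero ht) (insert 0 ((near WS t).map pt).toFinset)
    (fun z hz hne hd => ?_) ?_
  · rcases eq_of_shell_atom hz with rfl | ⟨s, hs, rfl⟩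
    · exact Finset.mem_insert_self _ _
    · exact Finset.mem_insert_of_mem (List.mem_toFinset.2 (List.mem_map.2 ⟨s, mem_near hs (fun h => hne (by rw [h])) (sq3_le_of_dist_le hd), rfl⟩))
  · calc (insert 0 ((near WS t).map pt).toFinset).card ≤ ((near WS t).map pt).toFinset.card + 1 := Finset.card_insert_le _ _
      _ ≤ (near WS t).length + 1 := by
          have h := List.toFinset_card_le ((near WS t).map pt)
          rw [List.length_map] at h
          omega
      _ < 16 := hlen

/-- ★ The 20 first-shell atoms of (434), as a finite set of points of `ℝ³`. [new: witness] -/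
def TS : Finset E3 := (WS20.map pt).toFinset

/-- It has exactly 20 points. [new: certificate] -/
theorem card_TS : TS.card = 20 := by
  have hnd : (WS20.map pt).Nodup := nodup_WS20.map_on fun s hs t ht h => ptS_injOn s (WS20_subset s hs) t (WS20_subset t ht) h
  rw [TS, List.toFinset_card_of_nodup hnd, List.length_map, length_WS20]

/-- ★ Every point of `TS` is an atom within `11/10` of the root, distinct from it, and UNDER-COORDINATED. [new: certificate] -/
theorem TS_spec : ∀ y ∈ TS, shellMeasure {y} ≠ 0 ∧ ‖y‖ ≤ 11 / 10 ∧ ¬ OverCoord (7 / 10) 16 (11 / 10) shellMeasure y := by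
  intro y hy
  simp only [TS, List.mem_toFinset, List.mem_map] at hy
  obtain ⟨t, ht, rfl⟩ := hy
  obtain ⟨h121, hlen⟩ := WS20_spec t ht
  exact ⟨shellMeasure_singleton_ne_zero (WS20_subset t ht), norm_pt_le h121, not_overCoord_shell (WS20_subset t ht) hlen⟩

/-- ★ THE (434) ROOT IS OVER-COORDINATED: its 20 first-shell atoms lie within `11/10`. [new: certificate] -/
theorem overCoord_shell_root : OverCoord (7 / 10) 16 (11 / 10) shellMeasure 0 := by
  refine overCoord_of_finset isRootedHardCore_shell shell_root_atom TS (fun z hz => ?_) (by rw [card_TS]; norm_num)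
  obtain ⟨hat, hn, -⟩ := TS_spec z hz
  have hz' : z ∈ (WS20.map pt).toFinset := hz
  rw [List.mem_toFinset, List.mem_map] at hz'
  obtain ⟨t, ht, rfl⟩ := hz'
  exact ⟨hat, ptS_ne_zero t (WS20_subset t ht), by rwa [dist_zero_right]⟩

/-- ★ The coordination pull books `≥ 20·a` at the (434) root — where every compression pull `r₁ ≤ 4/5` books `0` ((434) `net_compPull_shell`). -/
theorem net_shell_ge {a : ℝ} (ha : 0 ≤ a) : 20 * a ≤ net 0 (coordPull (7 / 10) 16 (11 / 10) (11 / 10) a) shellMeasure := by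
  have h := card_mul_le_net_coordPull (by norm_num) ha isRootedHardCore_shell overCoord_shell_root TS TS_spec
  rw [card_TS, show ((20 : ℕ) : ℝ) = 20 by norm_num] at h
  exact h

/-- `rootEnergy((434) witness) ≥ −2071/2000` (the exact value is `−1.03536…`). [new: certificate] -/
theorem rootEnergy_shell_ge : -(2071 / 2000 : ℝ) ≤ rootEnergy lennardJones shellMeasure := by
  rw [rootEnergy_shell]
  have h : (((-(2071 / 1000)) : ℚ) : ℝ) ≤ ((((WS.map fun t => gQ (sq3 t)).sum) : ℚ) : ℝ) := Rat.cast_le.2 sum_gQ_WS_ge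
  have h' : (((-(2071 / 1000)) : ℚ) : ℝ) = -(2071 / 1000) := by push_cast; norm_num
  linarith

/-- ★ THE TRANSPORTED DEFICIT OF THE (434) WITNESS under the coordination pull, against any ceiling `e⋆ ≤ E`: `≤ E + 2071/2000 − 20·a`. [new: negative] -/
theorem transportedDeficit_shell_le {a : ℝ} (ha : 0 ≤ a) {E : ℝ} (hE : eStar ≤ E) :
    eStar - rootEnergy lennardJones shellMeasure - net 0 (coordPull (7 / 10) 16 (11 / 10) (11 / 10) a) shellMeasure ≤ E + 2071 / 2000 - 20 * a := by
  linarith [net_shell_ge ha, rootEnergy_shell_ge]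

/-! ## §5. ★★ Non-transfer of both floors of record -/

/-- ★★ **(410) IS INVISIBLE TO THE COORDINATION PULL**: for `a ≥ 1/30` its transported deficit is `≤ 0` (tree ceiling `e⋆ ≤ −0.7175`). [new: negative] -/
theorem transportedDeficit_cluster_nonpos {a : ℝ} (ha : 1 / 30 ≤ a) :
    eStar - rootEnergy lennardJones clusterMeasure - net 0 (coordPull (7 / 10) 16 (11 / 10) (11 / 10) a) clusterMeasure ≤ 0 := by
  have h := transportedDeficit_cluster_le (by linarith) eStar_le
  linarith

/-- ★★ **(434) IS INVISIBLE TO THE COORDINATION PULL**: for `a ≥ 1/60` its transported deficit is `≤ 0`. [new: negative] -/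
theorem transportedDeficit_shell_nonpos {a : ℝ} (ha : 1 / 60 ≤ a) :
    eStar - rootEnergy lennardJones shellMeasure - net 0 (coordPull (7 / 10) 16 (11 / 10) (11 / 10) a) shellMeasure ≤ 0 := by
  have h := transportedDeficit_shell_le (by linarith) eStar_le
  linarith

/-- ★★ BOTH WITNESSES OF RECORD SATISFY EVERY COORDINATION-PULL CAP `D ≥ 0` (`a ≥ 1/30`): their `hcapT` instances are no constraint. [new: negative] -/
theorem witnesses_capT {a D : ℝ} (ha : 1 / 30 ≤ a) (hD : 0 ≤ D) :
    eStar - rootEnergy lennardJones clusterMeasure - net 0 (coordPull (7 / 10) 16 (11 / 10) (11 / 10) a) clusterMeasure ≤ D ∧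
      eStar - rootEnergy lennardJones shellMeasure - net 0 (coordPull (7 / 10) 16 (11 / 10) (11 / 10) a) shellMeasure ≤ D :=
  ⟨(transportedDeficit_cluster_nonpos ha).trans hD, (transportedDeficit_shell_nonpos (by linarith)).trans hD⟩

/-- ★ (411)'s floor does NOT transfer: «the cap inequality at the (410) witness forces `capFloor ≤ D`» (`capFloor = 0.613…`, true sitewise) is FALSE
for the coordination-pull cap (take `D = 0`). [new: negative] -/
theorem not_capFloor_transfer_coordPull {a : ℝ} (ha : 1 / 30 ≤ a) :
    ¬ ∀ D : ℝ, eStar - rootEnergy lennardJones clusterMeasure - net 0 (coordPull (7 / 10) 16 (11 / 10) (11 / 10) a) clusterMeasure ≤ D →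
      capFloor ≤ D := fun h => by
  have h0 := h 0 (transportedDeficit_cluster_nonpos ha)
  rw [capFloor_eq] at h0
  norm_num at h0

/-- ★ (434)'s floor does NOT transfer: «the cap inequality at the (434) witness forces `shellCapFloor ≤ D`» (`shellCapFloor = 0.2488…`, true for every
`compPull r₁ R a`, `r₁ ≤ 4/5`) is FALSE for the coordination-pull cap (take `D = 0`). [new: negative] -/
theorem not_shellCapFloor_transfer_coordPull {a : ℝ} (ha : 1 / 60 ≤ a) :
    ¬ ∀ D : ℝ, eStar - rootEnergy lennardJones shellMeasure - net 0 (coordPull (7 / 10) 16 (11 / 10) (11 / 10) a) shellMeasure ≤ D →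
      shellCapFloor ≤ D := fun h => by
  have h0 := h 0 (transportedDeficit_shell_nonpos ha)
  rw [shellCapFloor_eq] at h0
  norm_num at h0

/-! ## §6. Suffixed aliases (edition ED-1, critic r1932 (C)): unambiguous short names next to (421)'s compression-pull reading -/

/-- Alias of `net_cluster_ge` (the tree is append-only, so the homonyms of (421) stay and these suffixed names are ADDED; open these). [new: bookkeeping] -/
theorem net_cluster_ge_coordPull {a : ℝ} (ha : 0 ≤ a) : 21 * a ≤ net 0 (coordPull (7 / 10) 16 (11 / 10) (11 / 10) a) clusterMeasure := net_cluster_ge ha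

/-- Alias of `transportedDeficit_cluster_le`. [new: bookkeeping] -/
theorem transportedDeficit_cluster_le_coordPull {a : ℝ} (ha : 0 ≤ a) {E : ℝ} (hE : eStar ≤ E) :
    eStar - rootEnergy lennardJones clusterMeasure - net 0 (coordPull (7 / 10) 16 (11 / 10) (11 / 10) a) clusterMeasure ≤ E + 7 / 5 - 21 * a :=
  transportedDeficit_cluster_le ha hE

/-- Alias of `transportedDeficit_cluster_nonpos`. [new: bookkeeping] -/
theorem transportedDeficit_cluster_nonpos_coordPull {a : ℝ} (ha : 1 / 30 ≤ a) :
    eStar - rootEnergy lennardJones clusterMeasure - net 0 (coordPull (7 / 10) 16 (11 / 10) (11 / 10) a) clusterMeasure ≤ 0 :=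
  transportedDeficit_cluster_nonpos ha

/-- Alias of `net_shell_ge`. [new: bookkeeping] -/
theorem net_shell_ge_coordPull {a : ℝ} (ha : 0 ≤ a) : 20 * a ≤ net 0 (coordPull (7 / 10) 16 (11 / 10) (11 / 10) a) shellMeasure := net_shell_ge ha

/-- Alias of `transportedDeficit_shell_le`. [new: bookkeeping] -/
theorem transportedDeficit_shell_le_coordPull {a : ℝ} (ha : 0 ≤ a) {E : ℝ} (hE : eStar ≤ E) :
    eStar - rootEnergy lennardJones shellMeasure - net 0 (coordPull (7 / 10) 16 (11 / 10) (11 / 10) a) shellMeasure ≤ E + 2071 / 2000 - 20 * a :=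
  transportedDeficit_shell_le ha hE

/-- Alias of `transportedDeficit_shell_nonpos`. [new: bookkeeping] -/
theorem transportedDeficit_shell_nonpos_coordPull {a : ℝ} (ha : 1 / 60 ≤ a) :
    eStar - rootEnergy lennardJones shellMeasure - net 0 (coordPull (7 / 10) 16 (11 / 10) (11 / 10) a) shellMeasure ≤ 0 :=
  transportedDeficit_shell_nonpos ha

end Summit.AtomisticToContinuum.Crystallization.Theorems.AperiodicFrustratedLawGap.Negative.OffAtlasCapCeilingCoordPull

end
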